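import Literature.MathematicalPhysics.QuantumFieldTheory.Balaban1983to89.B9Eq340StepLasso

/-!
# `Balaban1983to89.B9Eq340TaxiLasso` — T. Bałaban, *Propagators for lattice gauge theories in a background field*, Commun. Math. Phys. **99** (1985) 389–434
# [Balaban1985BackgroundPropagators], (3.40) p. 397 with (3.3) p. 391 and (3.35) p. 396: THE TAXICAB LASSO `U(Γ_{x,z})·U(z,z+e_κ)·U(Γ_{x,z+e_κ})⁻¹` IS A CONJUGATE OF
# THE SIGNED LASSO OF THE LATER LEGS — in BOTH regimes of the `κ`-leg (forward or backward from the block centre) — hence within `Σ(swept plaquette defects)` of `1`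
# (the two-sided replacement of `B9Eq340TaxiForward.norm_taxiLasso_sub_one_le`)

statement-level skeleton of published theorems with citation tags; proofs where landed; nothing here is a claim about the Yang–Mills mass gap

THE PRINT.  (3.40) p. 397 («a shortest contour Γ_{x,x′}»); def-Y's `parTaxiV`: legs in the directions `0, …, d−1`, each the shorter way round; (3.35) p. 396.

WHY THIS FILE (dag-n06-i gen 14, N06 bundle F4, row 26).  `B9Eq340StepLasso` made def-Y's transporter a signed step run.  Across the bond `⟨z, z+e_κ⟩` the two contours
`Γ_{x,z}`, `Γ_{x,z+e_κ}` share the legs before `κ`, their `κ`-legs differ by the one bond `⟨y, y+e_κ⟩` at the `κ`-leg endpoint `y` of `Γ_{x,z}` — whether that leg runs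
forward (one bond more) or backward (one bond less) — and their later legs are translates by `e_κ`; so the lasso is `(common prefix)·stepLasso κ (later legs) y·(prefix)⁻¹`
and `B9Eq340StepLasso.norm_stepLasso_sub_one_le` bounds it.  The only hypothesis is that the `κ`-leg does not flip regime between `z` and `z+e_κ` (no antipode):
`(z_κ − x_κ).val ≤ (x_κ − z_κ).val → 2((z_κ − x_κ).val + 1) < period` — true inside a double block (the sequel).

WHAT IS PROVED (sorry-free, 0 def).
* §1 ZMod bookkeeping (`val_add_one_of_lt`, `val_sub_add_val_sub`, …) and ★ `legSteps_succ` (the `κ`-leg to `t+1` = the `κ`-leg to `t` followed by the bond at its endpoint,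
  in both regimes).
* §2 `taxiRun_target_congr`, ★★ `parTaxiV_split` ∕ `parTaxiV_split_shift` (the two contours through the `κ`-leg endpoint `y`), ★★★ `taxiLasso_eq_conj`,
  ★★★ `norm_taxiLasso_sub_one_le` (`≤ stepDefect κ U ρ y`, `ρ` = the later legs' steps), `length_taxiSteps_le` (`|ρ| ≤ Σ` shorter-arc lengths).

HONEST SCOPE.  Elementary bookkeeping over def-Y's `parTaxiV`; nothing of [B9] asserted; count-neutral; N06 NOT discharged.  Cell `pub-ymgap` (HUMAN RULING D-0062),
Track A node N06 [B9], seat `pub-ymgap-dag-n06-i` (gen 14), 2026-08-27; a NEW file.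
-/

namespace Literature.MathematicalPhysics.QuantumFieldTheory.Balaban1983to89.B9Eq340TaxiLasso

open Finset
open T4RelativeLadder (UnitaryLike norm_conj_sub_one_eq)
open B9BackgroundsKLevelV1 (CfgV1 shiftsV1)
open B9Eq39Adjoint (plaqU)
open Node00 (parFwdV parBwdV taxiLegV taxiRun parTaxiV iterate_shift_apply taxiRun_fst_apply)
open B9Eq340StepLasso (stepRun stepEnd stepDefect stepLasso legSteps taxiSteps rungSites stepRun_append stepEnd_append stepEnd_shift unitaryLike_stepRun
  norm_stepLasso_sub_one_le stepRun_replicate_true stepRun_replicate_false stepEnd_replicate_true stepEnd_replicate_false taxiLegV_eq_stepRun taxiSteps_congr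
  taxiRun_eq_stepRun taxiSteps_shift stepDefect_le_of_forall length_rungSites)
open B10StarCount (shift_unshift unshift_shift)

variable {P : Params} {𝔸 : Type} [NormedRing 𝔸]

/-! ## §1 The `κ`-leg to `t` and to `t + 1` -/

section ZModFacts

variable {n : ℕ} [NeZero n]

/-- `(a + 1).val = a.val + 1` below the top. [cite: Balaban1985BackgroundPropagators, (3.1) p.390 (the periodic lattice), bookkeeping] -/
theorem val_add_one_of_lt {a : ZMod n} (h : a.val + 1 < n) : (a + 1).val = a.val + 1 := by
  have h1 : (1 : ZMod n).val = 1 % n := ZMod.val_one_eq_one_mod n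
  have hn : 1 % n = 1 := Nat.mod_eq_of_lt (by omega)
  rw [ZMod.val_add, h1, hn, Nat.mod_eq_of_lt h]

/-- `a.val + (−a).val = n` for `a ≠ 0`. [cite: Balaban1985BackgroundPropagators, (3.1) p.390, bookkeeping] -/
theorem val_add_val_neg {a : ZMod n} (h : a ≠ 0) : a.val + (-a).val = n := by
  rw [ZMod.neg_val, if_neg h]
  have := ZMod.val_lt a
  omega

/-- for `t ≠ c`: `(t − c).val + (c − t).val = n`. [cite: Balaban1985BackgroundPropagators, (3.40) p.397 (the two ways round), bookkeeping] -/
theorem val_sub_add_val_sub {c t : ZMod n} (h : t ≠ c) : (t - c).val + (c - t).val = n := by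
  rw [show c - t = -(t - c) by ring]
  exact val_add_val_neg (sub_ne_zero.2 h)

end ZModFacts

/-- ★ **THE `κ`-LEG TO `t + 1` IS THE `κ`-LEG TO `t` FOLLOWED BY ONE BOND** — in the forward regime (one step more) and in the backward regime (one step less, the bond
cancelling the last backward step) — provided the forward regime at `t` leaves room (`2((t−c).val + 1) < period`: no antipode between `t` and `t+1`).
[cite: Balaban1985BackgroundPropagators, (3.40) p.397, (3.3) p.391] -/
theorem legSteps_succ (U : CfgV1 P 𝔸) (κ : Fin P.d) (c t : ZMod (P.sitesPerDir 0)) (w : Site P 0)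
    (hF : (t - c).val ≤ (c - t).val → 2 * ((t - c).val + 1) < P.sitesPerDir 0) :
    stepEnd (legSteps κ c (t + 1)) w = (stepEnd (legSteps κ c t) w).shift κ ∧
      stepRun U (legSteps κ c (t + 1)) w = stepRun U (legSteps κ c t) w * U κ (stepEnd (legSteps κ c t) w) := by
  have hNp : 1 < P.sitesPerDir 0 := P.one_lt_sitesPerDir 0
  set a := (t - c).val with ha
  set b := (c - t).val with hb
  by_cases hreg : a ≤ b
  · -- forward regime at `t`, hence at `t + 1`
    have h2 := hF hreg
    have ha' : (t + 1 - c).val = a + 1 := by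
      rw [show t + 1 - c = (t - c) + 1 by ring]; exact val_add_one_of_lt (by omega)
    have hb' : (c - (t + 1)).val = P.sitesPerDir 0 - (a + 1) := by
      have hne : t + 1 ≠ c := fun h => by
        have : (t + 1 - c).val = 0 := by rw [h, sub_self, ZMod.val_zero]
        omega
      have := val_sub_add_val_sub hne
      omega
    have hreg' : (t + 1 - c).val ≤ (c - (t + 1)).val := by rw [ha', hb']; omega
    unfold legSteps
    rw [if_pos hreg, if_pos hreg', ha', ← ha, List.replicate_succ', stepEnd_append, stepRun_append]
    simp [stepEnd, stepRun]
  · -- backward regime at `t`: the leg to `t` is one backward step LONGER than the leg to `t + 1`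
    rw [not_le] at hreg
    have hne : t ≠ c := fun h => by simp [ha, hb, h] at hreg
    have hab : a + b = P.sitesPerDir 0 := val_sub_add_val_sub hne
    have hb1 : 1 ≤ b := by
      by_contra h0
      have : b = 0 := by omega
      have : c - t = 0 := (ZMod.val_eq_zero _).1 this
      exact hne (sub_eq_zero.1 this).symm
    obtain ⟨b', hbb'⟩ : ∃ b', b = b' + 1 := ⟨b - 1, by omega⟩
    have hb' : (c - (t + 1)).val = b' := by
      have e : c - t = (c - (t + 1)) + 1 := by ring
      have hlt : (c - (t + 1)).val + 1 < P.sitesPerDir 0 ∨ (c - (t + 1)).val + 1 = P.sitesPerDir 0 := by have := ZMod.val_lt (c - (t + 1)); omega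
      rcases hlt with hlt | hlt
      · have := val_add_one_of_lt hlt; rw [← e] at this; omega
      · exfalso
        have h1 : (c - t).val = ((c - (t + 1)).val + 1) % P.sitesPerDir 0 := by
          rw [e, ZMod.val_add, ZMod.val_one_eq_one_mod, Nat.add_mod_mod]
        rw [hlt, Nat.mod_self] at h1
        omega
    -- the leg to `t`: `b' + 1` backward steps; the leg to `t + 1`: `b'` backward steps (or `0` forward steps when `b' = 0`)
    have hsteps_t : legSteps κ c t = List.replicate b' (κ, false) ++ [(κ, false)] := by
      unfold legSteps; rw [if_neg (not_le.2 hreg), ← hb, hbb', List.replicate_succ']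
    have hsteps_t1 : legSteps κ c (t + 1) = List.replicate b' (κ, false) := by
      unfold legSteps
      by_cases h0 : b' = 0
      · -- `t + 1 = c`: both branches are the empty leg
        have hct : c - (t + 1) = 0 := (ZMod.val_eq_zero _).1 (by rw [hb', h0])
        have hct' : t + 1 - c = 0 := by rw [show t + 1 - c = -(c - (t + 1)) by ring, hct, neg_zero]
        simp [hct, hct', h0]
      · have ha' : (t + 1 - c).val = a + 1 := by
          rw [show t + 1 - c = (t - c) + 1 by ring]; exact val_add_one_of_lt (by omega)
        rw [if_neg (by rw [ha', hb']; omega), hb']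
    rw [hsteps_t, hsteps_t1, stepEnd_append, stepRun_append]
    simp only [stepEnd, stepRun, shift_unshift, mul_one, mul_assoc]
    refine ⟨trivial, ?_⟩
    rw [inv_mul_cancel, mul_one]

/-! ## §2 The taxicab lasso is a conjugate of the signed lasso of the later legs -/

/-- the state after the legs BEFORE `κ` (common to the contours towards `z` and `z + e_κ`). [cite: Balaban1985BackgroundPropagators, (3.40) p.397, bookkeeping] -/
def preState (U : CfgV1 P 𝔸) (x z : Site P 0) (l₁ : List (Fin P.d)) : Site P 0 × 𝔸ˣ := taxiRun U z l₁ (x, 1)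

/-- the endpoint `y` of the `κ`-leg of `Γ_{x,z}`. [cite: Balaban1985BackgroundPropagators, (3.40) p.397, bookkeeping] -/
def legPt (U : CfgV1 P 𝔸) (x z : Site P 0) (κ : Fin P.d) (l₁ : List (Fin P.d)) : Site P 0 :=
  stepEnd (legSteps κ (x κ) (z κ)) (preState U x z l₁).1

/-- the transporter of `Γ_{x,z}` up to the end of its `κ`-leg. [cite: Balaban1985BackgroundPropagators, (3.40) p.397, (3.3) p.391, bookkeeping] -/
def prefixT (U : CfgV1 P 𝔸) (x z : Site P 0) (κ : Fin P.d) (l₁ : List (Fin P.d)) : 𝔸ˣ :=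
  (preState U x z l₁).2 * stepRun U (legSteps κ (x κ) (z κ)) (preState U x z l₁).1

/-- a taxicab run splits at an intermediate direction. [cite: Balaban1985BackgroundPropagators, (3.40) p.397, bookkeeping] -/
theorem taxiRun_append_cons (U : CfgV1 P 𝔸) (z : Site P 0) (l₁ l₂ : List (Fin P.d)) (κ : Fin P.d) (s : Site P 0 × 𝔸ˣ) :
    taxiRun U z (l₁ ++ κ :: l₂) s = taxiRun U z l₂ (taxiLegV U z (taxiRun U z l₁ s) κ) := by
  simp [taxiRun, List.foldl_append, List.foldl_cons]

/-- runs towards two targets that agree in the listed directions coincide. [cite: Balaban1985BackgroundPropagators, (3.40) p.397, bookkeeping] -/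
theorem taxiRun_target_congr (U : CfgV1 P 𝔸) {z z' : Site P 0} {l : List (Fin P.d)} (hl : l.Nodup) (h : ∀ μ ∈ l, z' μ = z μ) (s : Site P 0 × 𝔸ˣ) :
    taxiRun U z' l s = taxiRun U z l s := by
  rw [taxiRun_eq_stepRun U z' l hl s, taxiRun_eq_stepRun U z l hl s, taxiSteps_congr (fun _ _ => rfl) h]

/-- splitting the direction list at `κ`: the parts are duplicate-free and miss `κ`. [cite: Balaban1985BackgroundPropagators, (3.40) p.397, bookkeeping] -/
theorem split_nodup {κ : Fin P.d} {l₁ l₂ : List (Fin P.d)} (hl : List.finRange P.d = l₁ ++ κ :: l₂) :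
    l₁.Nodup ∧ κ ∉ l₁ ∧ l₂.Nodup ∧ κ ∉ l₂ := by
  have hnd : (l₁ ++ κ :: l₂).Nodup := hl ▸ List.nodup_finRange _
  have hnd2 : (κ :: l₂).Nodup := (List.nodup_append.1 hnd).2.1
  exact ⟨(List.nodup_append.1 hnd).1, fun h => (List.nodup_append.1 hnd).2.2 _ h _ (by simp) rfl, (List.nodup_cons.1 hnd2).2, (List.nodup_cons.1 hnd2).1⟩

/-- the prefix transporter is a signed step run (hence unitary-like for unitary-like bond variables). [cite: Balaban1985BackgroundPropagators, (3.40) p.397, bookkeeping] -/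
theorem prefixT_eq_stepRun (U : CfgV1 P 𝔸) (x z : Site P 0) (κ : Fin P.d) {l₁ : List (Fin P.d)} (hl1 : l₁.Nodup) :
    prefixT U x z κ l₁ = stepRun U (taxiSteps l₁ x z) x * stepRun U (legSteps κ (x κ) (z κ)) (preState U x z l₁).1 := by
  unfold prefixT preState
  rw [taxiRun_eq_stepRun U z l₁ hl1 (x, 1), one_mul]

/-- ★★ **THE TWO CONTOURS THROUGH THE `κ`-LEG ENDPOINT**: with `List.finRange d = l₁ ++ κ :: l₂`, `y = legPt`, `Π = prefixT`, `ρ = taxiSteps l₂ y z`: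
`U(Γ_{x,z}) = Π·stepRun ρ y`, `U(Γ_{x,z+e_κ}) = Π·U_κ(y)·stepRun ρ (y+e_κ)`, and `ρ` from `y` ends at `z` — in both regimes of the `κ`-leg (hypothesis: no antipode).
[cite: Balaban1985BackgroundPropagators, (3.40) p.397, (3.3) p.391] -/
theorem parTaxiV_split (U : CfgV1 P 𝔸) (x z : Site P 0) (κ : Fin P.d) {l₁ l₂ : List (Fin P.d)} (hl : List.finRange P.d = l₁ ++ κ :: l₂)
    (hF : (z κ - x κ).val ≤ (x κ - z κ).val → 2 * ((z κ - x κ).val + 1) < P.sitesPerDir 0) :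
    parTaxiV U x z = prefixT U x z κ l₁ * stepRun U (taxiSteps l₂ (legPt U x z κ l₁) z) (legPt U x z κ l₁) ∧
      parTaxiV U x (z.shift κ) = prefixT U x z κ l₁ * U κ (legPt U x z κ l₁) * stepRun U (taxiSteps l₂ (legPt U x z κ l₁) z) ((legPt U x z κ l₁).shift κ) ∧
      stepEnd (taxiSteps l₂ (legPt U x z κ l₁) z) (legPt U x z κ l₁) = z := by
  obtain ⟨hl1, hκ1, hl2, hκ2⟩ := split_nodup hl
  -- the common prefix: coordinate `κ` untouched
  have hwκ : (preState U x z l₁).1 κ = x κ := by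
    unfold preState; rw [taxiRun_fst_apply, if_neg hκ1]
  have hpre' : taxiRun U (z.shift κ) l₁ (x, 1) = preState U x z l₁ :=
    taxiRun_target_congr U hl1 (fun μ hμ => B6Ineq2142KLevelV1.shift_apply_of_ne z (μ := κ) (ν := μ) (fun h => hκ1 (h ▸ hμ))) _
  -- the `κ`-legs
  have hleg : taxiLegV U z (preState U x z l₁) κ = (legPt U x z κ l₁, prefixT U x z κ l₁) := by
    rw [taxiLegV_eq_stepRun, hwκ]; rfl
  have hsucc := legSteps_succ U κ (x κ) (z κ) (preState U x z l₁).1 hF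
  have hleg' : taxiLegV U (z.shift κ) (preState U x z l₁) κ = ((legPt U x z κ l₁).shift κ, prefixT U x z κ l₁ * U κ (legPt U x z κ l₁)) := by
    rw [taxiLegV_eq_stepRun, hwκ]
    have hz : (z.shift κ) κ = z κ + 1 := by simp [Site.shift]
    rw [hz, hsucc.1, hsucc.2]
    simp only [legPt, prefixT, mul_assoc]
  -- the later legs
  have hrunz : taxiRun U z (List.finRange P.d) (x, 1) =
      (stepEnd (taxiSteps l₂ (legPt U x z κ l₁) z) (legPt U x z κ l₁), prefixT U x z κ l₁ * stepRun U (taxiSteps l₂ (legPt U x z κ l₁) z) (legPt U x z κ l₁)) := by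
    rw [hl, taxiRun_append_cons, show taxiRun U z l₁ (x, 1) = preState U x z l₁ from rfl, hleg, taxiRun_eq_stepRun U z l₂ hl2]
  have hrunz' : taxiRun U (z.shift κ) (List.finRange P.d) (x, 1) =
      (stepEnd (taxiSteps l₂ (legPt U x z κ l₁) z) ((legPt U x z κ l₁).shift κ),
        prefixT U x z κ l₁ * U κ (legPt U x z κ l₁) * stepRun U (taxiSteps l₂ (legPt U x z κ l₁) z) ((legPt U x z κ l₁).shift κ)) := by
    rw [hl, taxiRun_append_cons, hpre', hleg', taxiRun_eq_stepRun U (z.shift κ) l₂ hl2, taxiSteps_shift hκ2]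
  refine ⟨?_, ?_, ?_⟩
  · unfold parTaxiV; rw [hrunz]
  · unfold parTaxiV; rw [hrunz']
  · have h := Node00.taxiEnd_eq U x z
    unfold Node00.taxiEnd at h
    rw [hrunz] at h
    exact h

/-- ★★★ **THE TAXICAB LASSO IS A CONJUGATE OF THE SIGNED LASSO OF THE LATER LEGS**:
`U(Γ_{x,z})·U_κ(z)·U(Γ_{x,z+e_κ})⁻¹ = Π·stepLasso κ U ρ y·Π⁻¹`. [cite: Balaban1985BackgroundPropagators, (3.40) p.397, (3.3) p.391] -/
theorem taxiLasso_eq_conj (U : CfgV1 P 𝔸) (x z : Site P 0) (κ : Fin P.d) {l₁ l₂ : List (Fin P.d)} (hl : List.finRange P.d = l₁ ++ κ :: l₂)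
    (hF : (z κ - x κ).val ≤ (x κ - z κ).val → 2 * ((z κ - x κ).val + 1) < P.sitesPerDir 0) :
    parTaxiV U x z * U κ z * (parTaxiV U x (z.shift κ))⁻¹ =
      prefixT U x z κ l₁ * stepLasso κ U (taxiSteps l₂ (legPt U x z κ l₁) z) (legPt U x z κ l₁) * (prefixT U x z κ l₁)⁻¹ := by
  obtain ⟨h1, h2, h3⟩ := parTaxiV_split U x z κ hl hF
  rw [h1, h2, stepLasso, h3]
  simp only [mul_inv_rev]
  group

/-- ★★★ **THE TAXICAB LASSO IS SMALL WHERE THE LATER LEGS' PLAQUETTES ARE**: for unitary-like bond variables,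
`‖U(Γ_{x,z})·U_κ(z)·U(Γ_{x,z+e_κ})⁻¹ − 1‖ ≤ stepDefect κ U ρ y` (`ρ` = the later legs' signed steps from the `κ`-leg endpoint `y`), in both regimes.
[cite: Balaban1985BackgroundPropagators, (3.40) p.397, (3.35) p.396; Balaban1985Averaging, (44)–(47) pp.24–25] -/
theorem norm_taxiLasso_sub_one_le [NormOneClass 𝔸] {U : CfgV1 P 𝔸} (hU : ∀ μ y, UnitaryLike (U μ y)) (x z : Site P 0) (κ : Fin P.d)
    {l₁ l₂ : List (Fin P.d)} (hl : List.finRange P.d = l₁ ++ κ :: l₂)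
    (hF : (z κ - x κ).val ≤ (x κ - z κ).val → 2 * ((z κ - x κ).val + 1) < P.sitesPerDir 0) :
    ‖((parTaxiV U x z * U κ z * (parTaxiV U x (z.shift κ))⁻¹ : 𝔸ˣ) : 𝔸) - 1‖ ≤
      stepDefect κ U (taxiSteps l₂ (legPt U x z κ l₁) z) (legPt U x z κ l₁) := by
  rw [taxiLasso_eq_conj U x z κ hl hF, Units.val_mul, Units.val_mul]
  have hpre : UnitaryLike (prefixT U x z κ l₁) := by
    rw [prefixT_eq_stepRun U x z κ (split_nodup hl).1]
    exact (unitaryLike_stepRun hU _ _).mul (unitaryLike_stepRun hU _ _)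
  rw [norm_conj_sub_one_eq hpre]
  exact norm_stepLasso_sub_one_le hU κ _ _

end Literature.MathematicalPhysics.QuantumFieldTheory.Balaban1983to89.B9Eq340TaxiLasso
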